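import Mathlib
import HarnessLib
import Literature.Probability.MarkovChains.TimeAverageConcentration

/-!
# Discounted costs: `φ = E Σ αⁿ c(X_n)` is the unique bounded solution of `φ = αPφ + c` (Norris, Theorem 4.2.5)

HONEST FRAMING: exact (Metropolis-corrected) sampling algorithms for lattice gauge theory; figures
of merit are autocorrelation/cost numbers at stated couplings and volumes; no continuum-physics claim.

Source: J. R. Norris, *Markov Chains*, Cambridge University Press 1997 [Norris1997], §4.2
"Potential theory", Theorem 4.2.5 with its proof: for a bounded cost `c` and a
discount factor `α ∈ (0,1)`, `φ_i = E_i Σ_{n≥0} αⁿ c(X_n)` is the unique bounded solution of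
`φ = αPφ + c`.  Everything is PROVED (0 named facts); finite state space (so every `c` and every
solution is bounded; we keep the printed sup-norm bound `|φ_i| ≤ C/(1−α)`).

`E_i c(X_n) = (Pⁿc)_i`, so `φ_i = Σ_{n≥0} αⁿ (Pⁿc)_i` — this is the DEFINITION of
`discountedPotential P α c` (a convergent series, `summable_discountedTerm`).

* `abs_pow_mulVec_le_sup` — `|(Pⁿc)_i| ≤ C` when `|c| ≤ C` [cite: Norris1997, §4.2, proof of Thm 4.2.5
  ("`|φ_i| ≤ C Σ αⁿ = C/(1−α)`")];
* `abs_discountedPotential_le` — `|φ_i| ≤ C/(1−α)` [cite: Norris1997, §4.2, proof of Thm 4.2.5];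
* `discountedPotential_eq` — `φ = c + αPφ` ("by the Markov property …") [cite: Norris1997, §4.2
  Thm 4.2.5 (existence)];
* `Norris1997_thm_4_2_5_unique` — a (bounded) solution `ψ = c + αPψ` equals `φ` ("`M ≤ αM`, which
  forces `M = 0`") [cite: Norris1997, §4.2 Thm 4.2.5 (uniqueness)];
* `Norris1997_thm_4_2_5` — packaged [cite: Norris1997, §4.2 Thm 4.2.5].

Context (cell pub-lqcd, venture LatticeQCDFlow): geometrically discounted accumulated observables
(`Σ αⁿ c(X_n)`) are the resolvent `(I − αP)⁻¹c` — the object behind exponential-autocorrelation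
and "effective sample size with forgetting factor" computations; uniqueness is the contraction
argument, valid without irreducibility.
-/

namespace Literature.Probability.MarkovChains

open Finset Matrix

variable {X : Type*} [Fintype X] [DecidableEq X] {P : Matrix X X ℝ} {α : ℝ} {c : X → ℝ}

/-- `|(Pⁿc)_i| ≤ C` for a transition matrix `P` and `|c_j| ≤ C`: `E_i|c(X_n)| ≤ C`.
[cite: Norris1997, §4.2, proof of Thm 4.2.5 ("Suppose that `|c_i| ≤ C` for all `i`")] -/
theorem abs_pow_mulVec_le_sup (hP : IsRowStochastic P) {C : ℝ} (hc : ∀ j, |c j| ≤ C) (n : ℕ) (i : X) :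
    |(P ^ n *ᵥ c) i| ≤ C := by
  rw [mulVec, dotProduct]
  calc |∑ j, (P ^ n) i j * c j| ≤ ∑ j, |(P ^ n) i j * c j| := abs_sum_le_sum_abs _ _
    _ = ∑ j, (P ^ n) i j * |c j| := sum_congr rfl fun j _ => by
        rw [abs_mul, abs_of_nonneg (Matrix.pow_apply_nonneg hP.1 n i j)]
    _ ≤ ∑ j, (P ^ n) i j * C := sum_le_sum fun j _ =>
        mul_le_mul_of_nonneg_left (hc j) (Matrix.pow_apply_nonneg hP.1 n i j)
    _ = C := by rw [← sum_mul, sum_pow_apply_eq_one hP n i, one_mul]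

/-- The discounted terms `αⁿ (Pⁿc)_i` are absolutely summable for `0 ≤ α < 1` (dominated by
`C αⁿ`). [cite: Norris1997, §4.2, proof of Thm 4.2.5 ("`|φ_i| ≤ C Σ_{n=0}^∞ αⁿ`")] -/
theorem summable_discountedTerm (hP : IsRowStochastic P) (hα0 : 0 ≤ α) (hα1 : α < 1) (c : X → ℝ)
    (i : X) : Summable fun n : ℕ => α ^ n * (P ^ n *ᵥ c) i := by
  classical
  obtain ⟨C, hC⟩ : ∃ C, ∀ j, |c j| ≤ C := by
    rcases isEmpty_or_nonempty X with hX | hX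
    · exact ⟨0, fun j => (hX.false j).elim⟩
    · obtain ⟨j₀, -, h⟩ := exists_max_image (univ : Finset X) (fun j => |c j|) univ_nonempty
      exact ⟨_, fun j => h j (mem_univ j)⟩
  refine Summable.of_norm_bounded ((summable_geometric_of_lt_one hα0 hα1).mul_left C) fun n => ?_
  rw [Real.norm_eq_abs, abs_mul, abs_pow, abs_of_nonneg hα0, mul_comm C]
  exact mul_le_mul_of_nonneg_left (abs_pow_mulVec_le_sup hP hC n i) (pow_nonneg hα0 n)

/-- The discounted potential `φ_i = E_i Σ_{n≥0} αⁿ c(X_n) = Σ_{n≥0} αⁿ (Pⁿc)_i`.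
[cite: Norris1997, §4.2 Thm 4.2.5 (definition of `φ`)] -/
noncomputable def discountedPotential (P : Matrix X X ℝ) (α : ℝ) (c : X → ℝ) (i : X) : ℝ :=
  ∑' n : ℕ, α ^ n * (P ^ n *ᵥ c) i

/-- **`|φ_i| ≤ C/(1−α)`** for `|c| ≤ C`, `0 ≤ α < 1`. [cite: Norris1997, §4.2, proof of Thm 4.2.5
("`|φ_i| ≤ C Σ_{n=0}^∞ αⁿ = C/(1−α)`, so `φ` is bounded")] -/
theorem abs_discountedPotential_le (hP : IsRowStochastic P) (hα0 : 0 ≤ α) (hα1 : α < 1) {C : ℝ}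
    (hc : ∀ j, |c j| ≤ C) (i : X) : |discountedPotential P α c i| ≤ C / (1 - α) := by
  rw [discountedPotential]
  have hs := summable_discountedTerm hP hα0 hα1 c i
  have hg := (summable_geometric_of_lt_one hα0 hα1).mul_left C
  calc |∑' n : ℕ, α ^ n * (P ^ n *ᵥ c) i| ≤ ∑' n : ℕ, |α ^ n * (P ^ n *ᵥ c) i| := by
        have := norm_tsum_le_tsum_norm hs.norm
        simpa only [Real.norm_eq_abs] using this
    _ ≤ ∑' n : ℕ, C * α ^ n := by
        refine Summable.tsum_le_tsum (fun n => ?_) hs.abs hg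
        rw [abs_mul, abs_pow, abs_of_nonneg hα0, mul_comm C]
        exact mul_le_mul_of_nonneg_left (abs_pow_mulVec_le_sup hP hc n i) (pow_nonneg hα0 n)
    _ = C / (1 - α) := by rw [tsum_mul_left, tsum_geometric_of_lt_one hα0 hα1, div_eq_mul_inv]

/-- **Existence: `φ = c + αPφ`** ("by the Markov property
`E(Σ_{n≥1} α^{n−1} c(X_n) | X_1 = j) = φ_j`, then `φ_i = c_i + α Σ_j p_ij φ_j`").
[cite: Norris1997, §4.2 Thm 4.2.5] -/
theorem discountedPotential_eq (hP : IsRowStochastic P) (hα0 : 0 ≤ α) (hα1 : α < 1) (i : X) :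
    discountedPotential P α c i = c i + α * ∑ j, P i j * discountedPotential P α c j := by
  have hs := summable_discountedTerm hP hα0 hα1 c
  rw [discountedPotential, (hs i).tsum_eq_zero_add]
  simp only [pow_zero, one_mul, one_mulVec]
  congr 1
  -- `Σ_{n≥0} α^{n+1} (P^{n+1}c)_i = α Σ_j p_ij Σ_{n≥0} αⁿ (Pⁿc)_j`
  have hterm : ∀ n : ℕ, α ^ (n + 1) * (P ^ (n + 1) *ᵥ c) i =
      ∑ j, α * (P i j * (α ^ n * (P ^ n *ᵥ c) j)) := by
    intro n
    rw [pow_succ' P n, ← mulVec_mulVec, mulVec, dotProduct, pow_succ, mul_sum]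
    exact sum_congr rfl fun j _ => by ring
  simp_rw [hterm]
  rw [Summable.tsum_finsetSum (fun j _ => ((hs j).mul_left (P i j)).mul_left α), mul_sum]
  exact sum_congr rfl fun j _ => by
    rw [tsum_mul_left, tsum_mul_left, discountedPotential]

/-- **Uniqueness ("`M ≤ αM`, which forces `M = 0` and `ψ = φ`").**  Any solution `ψ` of
`ψ = c + αPψ` on the finite state space (hence bounded) equals `φ`. [cite: Norris1997, §4.2
Thm 4.2.5 (uniqueness part of the proof)] -/
theorem Norris1997_thm_4_2_5_unique (hP : IsRowStochastic P) (hα0 : 0 ≤ α) (hα1 : α < 1)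
    {ψ : X → ℝ} (hψ : ∀ i, ψ i = c i + α * ∑ j, P i j * ψ j) : ψ = discountedPotential P α c := by
  classical
  set φ := discountedPotential P α c with hφ
  rcases isEmpty_or_nonempty X with hX | hX
  · funext i; exact (hX.false i).elim
  -- `M = sup_i |ψ_i − φ_i|`, attained at `i₀`
  obtain ⟨i₀, -, hmax⟩ := exists_max_image (univ : Finset X) (fun i => |ψ i - φ i|) univ_nonempty
  set M := |ψ i₀ - φ i₀| with hM
  have hle : ∀ i, |ψ i - φ i| ≤ M := fun i => hmax i (mem_univ i)
  -- `|ψ_i − φ_i| ≤ α Σ_j p_ij |ψ_j − φ_j| ≤ αM`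
  have hkey : M ≤ α * M := by
    have hd : ψ i₀ - φ i₀ = α * ∑ j, P i₀ j * (ψ j - φ j) := by
      rw [hψ i₀, hφ, discountedPotential_eq hP hα0 hα1 i₀, ← hφ]
      rw [mul_sum, mul_sum, add_sub_add_left_eq_sub, ← sum_sub_distrib, mul_sum]
      exact sum_congr rfl fun j _ => by ring
    calc M = |α * ∑ j, P i₀ j * (ψ j - φ j)| := by rw [hM, hd]
      _ ≤ α * ∑ j, P i₀ j * |ψ j - φ j| := by
          rw [abs_mul, abs_of_nonneg hα0]
          refine mul_le_mul_of_nonneg_left ((abs_sum_le_sum_abs _ _).trans (le_of_eq ?_)) hα0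
          exact sum_congr rfl fun j _ => by rw [abs_mul, abs_of_nonneg (hP.1 i₀ j)]
      _ ≤ α * ∑ j, P i₀ j * M := mul_le_mul_of_nonneg_left
          (sum_le_sum fun j _ => mul_le_mul_of_nonneg_left (hle j) (hP.1 i₀ j)) hα0
      _ = α * M := by rw [← sum_mul, hP.2 i₀, one_mul]
  have hM0 : M = 0 := by
    have hMnn : 0 ≤ M := abs_nonneg _
    nlinarith
  funext i
  have := hle i
  rw [hM0] at this
  exact sub_eq_zero.1 (abs_nonpos_iff.1 this)

/-- **THEOREM 4.2.5 (Norris).**  For `0 ≤ α < 1` (and any cost `c` on the finite state space):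
`φ_i = E_i Σ_{n≥0} αⁿ c(X_n)` satisfies `φ = αPφ + c`, and it is the unique (bounded) solution.
[cite: Norris1997, §4.2 Thm 4.2.5] -/
theorem Norris1997_thm_4_2_5 (hP : IsRowStochastic P) (hα0 : 0 ≤ α) (hα1 : α < 1) :
    (∀ i, discountedPotential P α c i = c i + α * ∑ j, P i j * discountedPotential P α c j) ∧
      ∀ ψ : X → ℝ, (∀ i, ψ i = c i + α * ∑ j, P i j * ψ j) → ψ = discountedPotential P α c :=
  ⟨discountedPotential_eq hP hα0 hα1, fun _ hψ => Norris1997_thm_4_2_5_unique hP hα0 hα1 hψ⟩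

end Literature.Probability.MarkovChains
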